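import Mathlib
import Literature.AlgebraicGeometry.Resolution.AffineBlowupAlgebra
import Summits.ResolutionOfSingularities.ResolutionOfSingularities.Theorems.WildQuotientsWildQuotientResolutionJordanThreeChartsA
import Summits.ResolutionOfSingularities.ResolutionOfSingularities.Theorems.WildQuotientsWildQuotientResolutionToricChartLemmas
/-!
# Toric chart certificates — the chart theorem: a checked certificate makes the vertex chart regular

(crux stmt-ResolutionOfSingularities-15640 `WildQuotients.WildQuotientResolution`, line `Sketch`,
sector `|G| = p`; next rung R-T — the cone lane, soundness of toric chart certificates, part 3/4.
[OURS · L1 W4.5c] — NOT a statement of any manuscript; replaces the role of no printed item.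
Prover res-L1-w45c-stub-4 (gen 4).)

`isRegularRing_chartRing_of_check`: for a cone datum `D`, a monomial centre `G : Fin m → Word d r`
(`cc l = wordElem (G l)`), a vertex `j₀` and a certificate `C` with `C.check D G j₀ = true`, the
chart ring `(A[𝔞t])_{(cc j₀ · t)}` of `Bl_𝔞 Spec A` is a regular ring. Proof: the chart map
`φ : k[x_s, passengers] → A[1/cc j₀]`, `x_s ↦ u_s = num s · (cc j₀)^{-K s}`, takes values in the
affine blow-up algebra `A[𝔞 / cc j₀]` (`num s ∈ 𝔞^{K s}`); its range contains `A` (tables `lamP`,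
`lamM`: each cone symbol is a monomial in the `u_s` — an identity of `x`-exponents, transported by the
injective `θ : A → k[x]`) and the fractions `cc l / cc j₀` (table `mu`), so by
`JordanThree.range_eq_blowupAlgebra_of_chart` the range IS the blow-up algebra; and `φ` is
injective because its composite with `A[1/cc j₀] → k[x^{±1}]` (the presentation followed by the
Laurent embedding; `cc j₀ ↦` a unit) is the Laurent monomial map of the exponent matrix of the
`u_s`, which has the integer quasi-inverse `Binv` (`aeval_laurentMonomial_injective`). Conclude by
`JordanThree.isRegularRing_chartRing_of_chart`.
-/

-- single-problem summit: the doubled namespace component `ResolutionOfSingularities` is forced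
set_option linter.dupNamespace false

noncomputable section

open MvPolynomial IsLocalization
open Literature.AlgebraicGeometry.Resolution

namespace Summit.ResolutionOfSingularities.ResolutionOfSingularities.Theorems.WildQuotientResolution.ToricChart

variable {d r : ℕ}

section Chart

variable (k : Type) [Field k] (P : Type) (D : ConeDatum d r) {m : ℕ} (G : Fin m → Word d r)
  (j₀ : Fin m) (C : ChartCert d r m)

/-- **The chart theorem**: a valid certificate makes the chart ring `(A[𝔞t])_{(cc j₀ t)}` of the
blow-up of the cone ring `A` along the monomial centre `𝔞 = (wordElem (G l))_l` a regular ring (it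
is a polynomial ring over `k`). [OURS · L1 W4.5c] -/
theorem isRegularRing_chartRing_of_check [Finite P] (hV : C.check D G j₀ = true) :
    IsRegularRing (chartRing (fun l : Fin m => wordElem k P D (G l)) j₀) := by
  classical
  obtain ⟨hV0, hV1, hV2, hV3, hdet, hV4⟩ := of_decide_eq_true hV
  -- notation
  let Pr := MvPolynomial ((Fin d ⊕ P) ⊕ Fin r) k
  let A := Ring k P D
  let π : Pr →ₐ[k] A := Ideal.Quotient.mkₐ k _
  have hπ : ∀ F : Pr, π F = Ideal.Quotient.mk _ F := fun F => rfl
  let cc : Fin m → A := fun l => wordElem k P D (G l)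
  change IsRegularRing (chartRing cc j₀)
  let L := Localization.Away (cc j₀)
  let am : A →+* L := algebraMap A L
  let ι : L := Away.invSelf (cc j₀)
  have hinv : am (cc j₀) * ι = 1 := Away.mul_invSelf (S := L) (cc j₀)
  haveI : IsRegularRing (MvPolynomial (Fin d ⊕ P) k) := MvPolynomial.isRegularRing_of_isRegularRing k
  let g₀ : Fin d → ℕ := wordExp D (G j₀)
  have hθcc : ∀ l, theta (cc l) = xmon k P (wordExp D (G l)) := fun l => theta_wordElem (G l)
  -- fractions: `am x ι^e = am y ι^f` from `x cc^f = y cc^e`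
  have hfrac : ∀ (x y : A) (e f : ℕ), x * cc j₀ ^ f = y * cc j₀ ^ e →
      am x * ι ^ e = am y * ι ^ f := by
    intro x y e f h
    calc am x * ι ^ e = am x * ι ^ e * (am (cc j₀) * ι) ^ f := by rw [hinv, one_pow, mul_one]
      _ = am (x * cc j₀ ^ f) * ι ^ (e + f) := by rw [map_mul, map_pow]; ring
      _ = am (y * cc j₀ ^ e) * ι ^ (e + f) := by rw [h]
      _ = am y * ι ^ f * (am (cc j₀) * ι) ^ e := by rw [map_mul, map_pow]; ring
      _ = am y * ι ^ f := by rw [hinv, one_pow, mul_one]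
  -- equalities in `A` from exponent identities
  have hAeq : ∀ (x y : A) (ex ey : Fin d → ℕ), theta x = xmon k P ex → theta y = xmon k P ey →
      ex = ey → x = y := by
    intro x y ex ey hx hy h
    apply theta_injective
    rw [hx, hy, h]
  -- the chart map
  let nu : Fin d → A := fun s => num k P D G C s
  let v : Fin d ⊕ P → L := Sum.elim (fun s => am (nu s) * ι ^ C.K s)
    (fun p => am (π (X (Sum.inl (Sum.inr p)))))
  let φ : MvPolynomial (Fin d ⊕ P) k →ₐ[k] L := aeval v
  have hφs : ∀ s, φ (X (Sum.inl s)) = am (nu s) * ι ^ C.K s := fun s => by simp [φ, v]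
  have hφp : ∀ p, φ (X (Sum.inr p)) = am (π (X (Sum.inl (Sum.inr p)))) := fun p => by simp [φ, v]
  have hπC : ∀ c : k, π (MvPolynomial.C c) = algebraMap k A c := fun c => π.commutes c
  have hφC : ∀ c : k, φ (MvPolynomial.C c) = am (π (MvPolynomial.C c)) := by
    intro c
    have h1 : φ (MvPolynomial.C c) = algebraMap k L c := aeval_C v c
    rw [h1, hπC, IsScalarTower.algebraMap_apply k A L]
  -- φ of a monomial in the distinguished variables
  have hφmon : ∀ c : Fin d → ℕ, φ (xmon k P c) =
      am (∏ s : Fin d, nu s ^ c s) * ι ^ (fsum d fun s => c s * C.K s) := by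
    intro c
    rw [xmon, map_prod]
    simp only [map_pow, hφs]
    rw [prod_mul_pow_pow, map_prod, fsum_eq_sum]
    simp only [map_pow]
  -- (1) values in the blow-up algebra
  have hnumem : ∀ s, nu s ∈ Ideal.span (Set.range cc) ^ C.K s := by
    intro s
    have h := prod_pow_mem_pow (Ideal.span (Set.range cc)) Finset.univ cc
      (fun l _ => Ideal.subset_span ⟨l, rfl⟩) (C.numG s)
    rw [← fsum_eq_sum, hV0 s] at h
    exact Ideal.mul_mem_right _ _ h
  have hmem : ∀ p, (φ : MvPolynomial (Fin d ⊕ P) k →+* L) p ∈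
      blowupAlgebra (Ideal.span (Set.range cc)) (cc j₀) := by
    intro p
    induction p using MvPolynomial.induction_on with
    | C c =>
      rw [RingHom.coe_coe, hφC]
      exact Subalgebra.algebraMap_mem _ _
    | add p q hp hq =>
      rw [map_add]
      exact Subalgebra.add_mem _ hp hq
    | mul_X p i hp =>
      rw [map_mul]
      refine Subalgebra.mul_mem _ hp ?_
      rcases i with s | p'
      · rw [RingHom.coe_coe, hφs]
        exact algebraMap_mul_invSelf_pow_mem_blowupAlgebra (cc j₀) (C.K s) (hnumem s)
      · rw [RingHom.coe_coe, hφp]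
        exact Subalgebra.algebraMap_mem _ _
  have hfrac0 : ∀ (x y : A) (e : ℕ), x = y * cc j₀ ^ e → am x * ι ^ e = am y := by
    intro x y e h
    have h' := hfrac x y e 0 (by rw [pow_zero, mul_one, h])
    rwa [pow_zero, mul_one] at h'
  have hfrac1 : ∀ (x y : A) (e : ℕ), x * cc j₀ = y * cc j₀ ^ e → am x * ι ^ e = am y * ι := by
    intro x y e h
    have h' := hfrac x y e 1 (by rw [pow_one, h])
    rwa [pow_one] at h'
  -- (2) the base ring is in the range: symbols
  have hsymb_pure : ∀ s' : Fin d, am (π (X (Sum.inl (Sum.inl s')))) ∈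
      Set.range (φ : MvPolynomial (Fin d ⊕ P) k →+* L) := by
    intro s'
    refine ⟨xmon k P (C.lamP s'), ?_⟩
    rw [RingHom.coe_coe, hφmon]
    have hw : π (X (Sum.inl (Sum.inl s'))) = wordElem k P D (pureWord s') := by
      rw [hπ, wordElem, wordPoly_pureWord]
    rw [hw]
    refine hfrac0 _ _ _ (hAeq _ _ (fun t => fsum d fun s => C.lamP s' s * C.nexp D G s t)
      (fun t => wordExp D (pureWord s') t + (fsum d fun s => C.lamP s' s * C.K s) * g₀ t)
      (theta_prod_num_pow _) ?_ ?_)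
    · rw [map_mul, map_pow, theta_wordElem, hθcc, ← xmon_smul, ← xmon_add]
      rfl
    · funext t; exact (hV1 s' t).symm
  have hsymb_mixed : ∀ j : Fin r, am (π (X (Sum.inr j))) ∈
      Set.range (φ : MvPolynomial (Fin d ⊕ P) k →+* L) := by
    intro j
    refine ⟨xmon k P (C.lamM j), ?_⟩
    rw [RingHom.coe_coe, hφmon]
    have hw : π (X (Sum.inr j)) = wordElem k P D (mixedWord j) := by
      rw [hπ, wordElem, wordPoly_mixedWord]
    rw [hw]
    refine hfrac0 _ _ _ (hAeq _ _ (fun t => fsum d fun s => C.lamM j s * C.nexp D G s t)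
      (fun t => wordExp D (mixedWord j) t + (fsum d fun s => C.lamM j s * C.K s) * g₀ t)
      (theta_prod_num_pow _) ?_ ?_)
    · rw [map_mul, map_pow, theta_wordElem, hθcc, ← xmon_smul, ← xmon_add]
      rfl
    · funext t; exact (hV2 j t).symm
  have hsymb : ∀ σ : (Fin d ⊕ P) ⊕ Fin r, am (π (X σ)) ∈
      Set.range (φ : MvPolynomial (Fin d ⊕ P) k →+* L) := by
    rintro ((s' | p) | j)
    · exact hsymb_pure s'
    · exact ⟨X (Sum.inr p), by rw [RingHom.coe_coe, hφp]⟩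
    · exact hsymb_mixed j
  have hbase : ∀ x : A, am x ∈ Set.range (φ : MvPolynomial (Fin d ⊕ P) k →+* L) := by
    intro x
    obtain ⟨F, rfl⟩ := Ideal.Quotient.mk_surjective x
    change am (π F) ∈ _
    induction F using MvPolynomial.induction_on with
    | C c => exact ⟨MvPolynomial.C c, by rw [RingHom.coe_coe, hφC]⟩
    | add p q hp hq =>
      obtain ⟨p', hp'⟩ := hp
      obtain ⟨q', hq'⟩ := hq
      exact ⟨p' + q', by rw [map_add, hp', hq', map_add, map_add]⟩
    | mul_X p σ hp =>
      obtain ⟨p', hp'⟩ := hp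
      obtain ⟨s', hs'⟩ := hsymb σ
      exact ⟨p' * s', by rw [map_mul, hp', hs', map_mul, map_mul]⟩
  -- (3) the fractions `cc l / cc j₀` are in the range
  have hgen : ∀ l : Fin m, am (cc l) * ι ∈ Set.range (φ : MvPolynomial (Fin d ⊕ P) k →+* L) := by
    intro l
    refine ⟨xmon k P (C.mu l), ?_⟩
    rw [RingHom.coe_coe, hφmon]
    refine hfrac1 _ _ _ (hAeq _ _ (fun t => (fsum d fun s => C.mu l s * C.nexp D G s t) + g₀ t)
      (fun t => wordExp D (G l) t + (fsum d fun s => C.mu l s * C.K s) * g₀ t) ?_ ?_ ?_)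
    · rw [map_mul, theta_prod_num_pow, hθcc, ← xmon_add]
      rfl
    · rw [map_mul, map_pow, hθcc, hθcc, ← xmon_smul, ← xmon_add]
      rfl
    · funext t; exact (hV3 l t).symm
  have hrange := JordanThree.range_eq_blowupAlgebra_of_chart cc j₀
    (φ : MvPolynomial (Fin d ⊕ P) k →+* L) hmem hbase hgen
  -- (4) injectivity via Laurent polynomials
  let Λ₀ : A →+* Laurent k (Fin d ⊕ P) :=
    (toLaurent k (Fin d ⊕ P)).toRingHom.comp (theta (k := k) (P := P) (D := D)).toRingHom
  have hΛ₀ : ∀ x : A, Λ₀ x = toLaurent k (Fin d ⊕ P) (theta x) := fun x => rfl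
  let g₀v : (Fin d ⊕ P) →₀ ℤ := ∑ s : Fin d, g₀ s • Finsupp.single (Sum.inl s) (1 : ℤ)
  have hΛ₀cc : Λ₀ (cc j₀) = AddMonoidAlgebra.single g₀v (1 : k) := by
    rw [hΛ₀, hθcc, toLaurent_xmon]
  have hunit : IsUnit (Λ₀ (cc j₀)) := by rw [hΛ₀cc]; exact isUnit_single g₀v
  let Λ : L →+* Laurent k (Fin d ⊕ P) := IsLocalization.Away.lift (cc j₀) hunit
  have hΛam : ∀ x, Λ (am x) = Λ₀ x := fun x => IsLocalization.Away.lift_eq (cc j₀) hunit x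
  have hΛι : Λ ι = AddMonoidAlgebra.single (-g₀v) (1 : k) := by
    have h : Λ (am (cc j₀) * ι) = 1 := by rw [hinv, map_one]
    rw [map_mul, hΛam, hΛ₀cc] at h
    calc Λ ι = (AddMonoidAlgebra.single (-g₀v) (1 : k) * AddMonoidAlgebra.single g₀v 1) * Λ ι := by
            rw [AddMonoidAlgebra.single_mul_single, neg_add_cancel, mul_one,
              ← AddMonoidAlgebra.one_def, one_mul]
      _ = AddMonoidAlgebra.single (-g₀v) (1 : k) := by rw [mul_assoc, h, mul_one]
  -- Laurent exponents of the chart coordinates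
  let bz : Fin d → Fin d → ℤ := fun s t => (C.nexp D G s t : ℤ) - C.K s * g₀ t
  let B' : Fin d ⊕ P → ((Fin d ⊕ P) →₀ ℤ) := Sum.elim
    (fun s => ∑ t : Fin d, bz s t • Finsupp.single (Sum.inl t) (1 : ℤ))
    (fun p => Finsupp.single (Sum.inr p) 1)
  have hB'inl : ∀ s, B' (Sum.inl s) = ∑ t : Fin d, bz s t • Finsupp.single (Sum.inl t) (1 : ℤ) :=
    fun s => rfl
  have hB'inr : ∀ p, B' (Sum.inr p) = Finsupp.single (Sum.inr p) 1 := fun p => rfl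
  have hnexpv : ∀ s, (∑ t : Fin d, C.nexp D G s t • Finsupp.single (Sum.inl t : Fin d ⊕ P) (1 : ℤ)) =
      B' (Sum.inl s) + C.K s • g₀v := by
    intro s
    rw [hB'inl]
    change _ = _ + C.K s • ∑ t : Fin d, g₀ t • Finsupp.single (Sum.inl t) (1 : ℤ)
    rw [Finset.smul_sum, ← Finset.sum_add_distrib]
    refine Finset.sum_congr rfl fun t _ => ?_
    rw [← natCast_zsmul, ← natCast_zsmul _ (g₀ t), ← natCast_zsmul, smul_smul, ← add_smul]
    congr 1
    simp only [bz]
    ring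
  have hΛφ : ∀ w : Fin d ⊕ P, Λ (φ (X w)) = AddMonoidAlgebra.single (B' w) (1 : k) := by
    rintro (s | p)
    · rw [hφs, map_mul, map_pow, hΛam, hΛ₀, theta_num, toLaurent_xmon, hΛι, hnexpv,
        AddMonoidAlgebra.single_pow, one_pow, AddMonoidAlgebra.single_mul_single, mul_one]
      congr 1
      rw [smul_neg, add_neg_cancel_right]
    · rw [hφp, hΛam, hΛ₀, hπ, theta_mk, presentation_X_inl_inr, toLaurent_X, hB'inr]
  have hΛφ' : Λ.comp (φ : MvPolynomial (Fin d ⊕ P) k →+* L) =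
      ((MvPolynomial.aeval (R := k) (S₁ := Laurent k (Fin d ⊕ P))
        fun w => AddMonoidAlgebra.single (B' w) (1 : k)) : MvPolynomial (Fin d ⊕ P) k →+* _) := by
    refine MvPolynomial.ringHom_ext (fun c => ?_) (fun w => ?_)
    · rw [RingHom.coe_comp, Function.comp_apply, RingHom.coe_coe, RingHom.coe_coe, hφC, hΛam,
        hΛ₀, hπ, theta_mk, MvPolynomial.algHom_C, toLaurent, MvPolynomial.aeval_C,
        AlgHom.commutes]
    · rw [RingHom.coe_comp, Function.comp_apply, RingHom.coe_coe, RingHom.coe_coe, hΛφ,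
        MvPolynomial.aeval_X]
  -- the exponent map is injective: coordinate functionals
  have hcoord : ∀ (χ : ((Fin d ⊕ P) →₀ ℤ) →+ ℤ) (w₀ : Fin d ⊕ P) (c₀ : ℤ),
      (∀ w, χ (B' w) = if w = w₀ then c₀ else 0) →
      ∀ e : (Fin d ⊕ P) →₀ ℕ, χ (e.sum fun w n => (n : ℤ) • B' w) = c₀ * e w₀ := by
    intro χ w₀ c₀ hχ e
    rw [map_finsuppSum]
    simp only [map_zsmul, smul_eq_mul, hχ, mul_ite, mul_zero]
    rw [Finsupp.sum, Finset.sum_ite_eq']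
    split_ifs with hmem
    · ring
    · rw [Finsupp.mem_support_iff, not_not] at hmem
      rw [hmem, Nat.cast_zero, mul_zero]
  have hbz : ∀ s u, (B' (Sum.inl s)) (Sum.inl u) = bz s u := by
    intro s u
    rw [hB'inl, Finsupp.finsetSum_apply]
    simp only [Finsupp.smul_apply, Finsupp.single_apply, smul_eq_mul, mul_ite, mul_one, mul_zero,
      Sum.inl.injEq]
    rw [Finset.sum_ite_eq']
    simp
  have hB' : Function.Injective (fun e : (Fin d ⊕ P) →₀ ℕ => e.sum fun w n => (n : ℤ) • B' w) := by
    intro e e' h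
    ext w
    rcases w with u' | p
    · let χ : ((Fin d ⊕ P) →₀ ℤ) →+ ℤ :=
        { toFun := fun x => ∑ u : Fin d, x (Sum.inl u) * C.Binv u u'
          map_zero' := by simp
          map_add' := fun x y => by
            simp only [Finsupp.add_apply, add_mul, Finset.sum_add_distrib] }
      have hχ : ∀ w, χ (B' w) = if w = Sum.inl u' then C.det else 0 := by
        rintro (s | p)
        · change (∑ u : Fin d, (B' (Sum.inl s)) (Sum.inl u) * C.Binv u u') = _
          simp only [hbz]
          have h4 := hV4 s u'
          rw [fsum_eq_sum] at h4
          change (∑ u : Fin d, bz s u * C.Binv u u') = _ at h4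
          rw [h4]
          simp
        · change (∑ u : Fin d, (Finsupp.single (Sum.inr p : Fin d ⊕ P) (1 : ℤ)) (Sum.inl u) *
            C.Binv u u') = _
          simp
      have h1 := hcoord χ (Sum.inl u') C.det hχ e
      have h2 := hcoord χ (Sum.inl u') C.det hχ e'
      have h12 : C.det * (e (Sum.inl u') : ℤ) = C.det * e' (Sum.inl u') := by
        rw [← h1, ← h2]
        exact congrArg χ h
      exact_mod_cast mul_left_cancel₀ hdet h12
    · let χ : ((Fin d ⊕ P) →₀ ℤ) →+ ℤ := Finsupp.applyAddHom (Sum.inr p)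
      have hχ : ∀ w, χ (B' w) = if w = Sum.inr p then 1 else 0 := by
        rintro (s | p')
        · change (B' (Sum.inl s)) (Sum.inr p) = _
          rw [hB'inl, Finsupp.finsetSum_apply]
          simp
        · change (Finsupp.single (Sum.inr p' : Fin d ⊕ P) (1 : ℤ)) (Sum.inr p) = _
          simp only [Finsupp.single_apply]
      have h1 := hcoord χ (Sum.inr p) 1 hχ e
      have h2 := hcoord χ (Sum.inr p) 1 hχ e'
      have h12 : (1 : ℤ) * (e (Sum.inr p) : ℤ) = 1 * e' (Sum.inr p) := by
        rw [← h1, ← h2]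
        exact congrArg χ h
      rw [one_mul, one_mul] at h12
      exact_mod_cast h12
  have hinjΛφ := aeval_laurentMonomial_injective (k := k) B' hB'
  have hinj : Function.Injective (φ : MvPolynomial (Fin d ⊕ P) k →+* L) := by
    intro p q hpq
    apply hinjΛφ
    have h := congrArg Λ hpq
    change (Λ.comp (φ : MvPolynomial (Fin d ⊕ P) k →+* L)) p =
      (Λ.comp (φ : MvPolynomial (Fin d ⊕ P) k →+* L)) q at h
    rw [hΛφ'] at h
    exact h
  exact JordanThree.isRegularRing_chartRing_of_chart cc j₀ (φ : MvPolynomial (Fin d ⊕ P) k →+* L)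
    hinj hrange

end Chart

end Summit.ResolutionOfSingularities.ResolutionOfSingularities.Theorems.WildQuotientResolution.ToricChart

end
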